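import Summits.HubbardSuperconductivity.HubbardSuperconductivity.Theorems.AnisotropyChordInsertionEntropyFourier
import Summits.HubbardSuperconductivity.HubbardSuperconductivity.Theorems.AnisotropyChordInsertionEntropyUniformDensity

/-!
# Route `AnisotropyChord` / H0 rotor rung: the entropy route — the STRUCTURE-FACTOR IDENTITY for the
# insertion response, `δρ̂_x(k) = φ_k(x) [S_N(k) − 1 + ρ_M S_M(k)/(1 − ρ_M)]` (`k ≠ 0`), `δρ̂_x(0) = 0`

Theory seat memo ROTOR-THEORY-7 §91/§93 («the insertion response is pure two-point data»; checked to
`1.4e−12` on 42 ED points; used on paper in the reduction `EntropyRouteReduction`).  Here it is PROVED for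
the Perron sector ground amplitudes of the XXZ torus `(ℤ/L)²`, from translation covariance
(`perronAmplitude_comp_iso`) and the Fourier toolkit of `AnisotropyChordInsertionEntropyFourier`:

* `sum_ite_update_eq` — re-indexing configurations with `x` occupied by those with `x` empty;
* `sum_particleAt_mul_densityMode` — `Σ_σ n_x(σ) a(σ)² ρ_k(σ) = φ_k(x) · (Σ_σ a(σ)²|ρ_k(σ)|²)/L²`
  for every translation-invariant amplitude (`= φ_k(x) ρ S_a(k)`);
* `sum_sq_mul_densityMode` — `Σ_σ a(σ)² ρ_k(σ) = [k = 0] · P`;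
* `sum_holeLaw_mul_densityMode`, `sum_vacantLaw_mul_densityMode` — the transforms of the hole law
  `ν_x` and of the vacancy-conditioned law `π̃_x`;
* **`kernelFT_insertionResponse`** (`k ≠ 0`), **`kernelFT_insertionResponse_zero`**, and the bound
  **`norm_kernelFT_insertionResponse_le`**: `|δρ̂_x(k)| ≤ S_N(k) + 1 + ρ_M S_M(k)/(1 − ρ_M)`.
-/

set_option linter.dupNamespace false

noncomputable section

open Matrix Finset Filter Topology Complex
open scoped ComplexConjugate Real
open Literature.MathematicalPhysics.QuantumLattice Literature.Probability.LatticeModels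

namespace Summit.HubbardSuperconductivity.HubbardSuperconductivity.Theorems.AnisotropyChord.InsertionEntropy

variable {L : ℕ} [NeZero L]

/-! ## Re-indexing and translation covariance -/

/-- **Re-indexing by the particle at `x`:** `Σ_{τ : τ x = 1} G(τ with x ↦ 0) = Σ_{σ : σ x = 0} G(σ)`. [folklore] -/
theorem sum_ite_update_eq {β : Type*} [AddCommMonoid β] {V : Type} [Fintype V] [DecidableEq V]
    (G : (V → Fin 2) → β) (x : V) :
    ∑ τ : V → Fin 2, (if τ x = 1 then G (Function.update τ x 0) else 0)
      = ∑ σ : V → Fin 2, (if σ x = 0 then G σ else 0) := by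
  rw [← Finset.sum_filter, ← Finset.sum_filter]
  refine Finset.sum_bij' (fun τ _ => Function.update τ x 0) (fun σ _ => Function.update σ x 1)
    ?_ ?_ ?_ ?_ ?_
  · intro τ hτ; simp
  · intro σ hσ; simp
  · intro τ hτ
    simp only [Finset.mem_filter, Finset.mem_univ, true_and] at hτ
    rw [Function.update_idem, ← hτ, Function.update_eq_self]
  · intro σ hσ
    simp only [Finset.mem_filter, Finset.mem_univ, true_and] at hσ
    rw [Function.update_idem, ← hσ, Function.update_eq_self]
  · intro τ hτ; rfl

/-- `[τ x = 1] = 1 − [τ x = 0]` for `Fin 2`-valued configurations (as an `ite` of complex weights). [folklore] -/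
theorem ite_eq_one_eq_sub {V : Type} (τ : V → Fin 2) (x : V) (c : ℂ) :
    (if τ x = 1 then c else 0) = c - (if τ x = 0 then c else 0) := by
  rcases Fin.exists_fin_two.mp ⟨τ x, rfl⟩ with h | h
  · simp [h]
  · simp [h]

/-- **Perron amplitudes are translation invariant** (`shiftConfig` form of `perronAmplitude_comp_iso`). [folklore] -/
theorem perronAmplitude_shiftConfig (Δ M : ℝ) (a : TensorIndex (TorusSite 2 L) 2 → ℝ)
    (ha : IsPerronSectorGroundAmplitude L Δ M a) (v : TorusSite 2 L) (σ : TensorIndex (TorusSite 2 L) 2) :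
    a (shiftConfig L v σ) = a σ :=
  perronAmplitude_comp_iso L Δ M a ha (torusTranslationIso L v) σ

/-- **Translation covariance of the marked density mode:** for a translation-invariant weight `b`,
`Σ_σ n_x(σ) b(σ) ρ_k(σ) = φ_k(x) · Σ_σ n_0(σ) b(σ) ρ_k(σ)`. [folklore] -/
theorem sum_particleAt_mul_densityMode_eq_phase (b : TensorIndex (TorusSite 2 L) 2 → ℝ)
    (hb : ∀ v σ, b (shiftConfig L v σ) = b σ) (x k : TorusSite 2 L) :
    ∑ σ, (if σ x = 0 then (b σ : ℂ) else 0) * (∑ s, if σ s = 0 then torusPhase L k s else 0)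
      = torusPhase L k x *
        ∑ σ, (if σ 0 = 0 then (b σ : ℂ) else 0) * (∑ s, if σ s = 0 then torusPhase L k s else 0) := by
  rw [Finset.mul_sum]
  rw [← sum_config_comp_equiv (Equiv.addRight (-x))
    (fun σ => (if σ x = 0 then (b σ : ℂ) else 0) * (∑ s, if σ s = 0 then torusPhase L k s else 0))]
  refine Finset.sum_congr rfl fun σ _ => ?_
  have hshift : (σ ∘ (Equiv.addRight (-x))) = shiftConfig L (-x) σ := by
    funext s; rfl
  rw [hshift, densityMode_shiftConfig, hb, torusPhase_neg_right, Complex.conj_conj]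
  have hx : shiftConfig L (-x) σ x = σ 0 := by
    show σ (x + -x) = σ 0
    rw [add_neg_cancel]
  rw [hx]; ring

/-- `Σ_x conj φ_k(x) · Σ_σ n_x(σ) b(σ) ρ_k(σ) = Σ_σ b(σ) |ρ_k(σ)|²`. [folklore] -/
theorem sum_conj_phase_mul_particleAt (b : TensorIndex (TorusSite 2 L) 2 → ℝ) (k : TorusSite 2 L) :
    ∑ x, conj (torusPhase L k x) *
        ∑ σ, (if σ x = 0 then (b σ : ℂ) else 0) * (∑ s, if σ s = 0 then torusPhase L k s else 0)
      = ((∑ σ, b σ * ‖(∑ s, if σ s = 0 then torusPhase L k s else 0)‖ ^ 2 : ℝ) : ℂ) := by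
  rw [Complex.ofReal_sum]
  calc ∑ x, conj (torusPhase L k x) *
        ∑ σ, (if σ x = 0 then (b σ : ℂ) else 0) * (∑ s, if σ s = 0 then torusPhase L k s else 0)
      = ∑ x, ∑ σ, conj (torusPhase L k x) *
          ((if σ x = 0 then (b σ : ℂ) else 0) * (∑ s, if σ s = 0 then torusPhase L k s else 0)) := by
        refine Finset.sum_congr rfl fun x _ => ?_
        rw [Finset.mul_sum]
    _ = ∑ σ, ∑ x, conj (torusPhase L k x) *
          ((if σ x = 0 then (b σ : ℂ) else 0) * (∑ s, if σ s = 0 then torusPhase L k s else 0)) :=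
        Finset.sum_comm
    _ = ∑ σ, ((b σ * ‖(∑ s, if σ s = 0 then torusPhase L k s else 0)‖ ^ 2 : ℝ) : ℂ) := by
        refine Finset.sum_congr rfl fun σ _ => ?_
        have h : ∀ x, conj (torusPhase L k x) * ((if σ x = 0 then (b σ : ℂ) else 0)
            * (∑ s, if σ s = 0 then torusPhase L k s else 0))
            = ((b σ : ℂ) * (∑ s, if σ s = 0 then torusPhase L k s else 0))
              * (if σ x = 0 then conj (torusPhase L k x) else 0) := by
          intro x; split_ifs <;> ring
        rw [Finset.sum_congr rfl fun x _ => h x, ← Finset.mul_sum, sum_ite_conj_torusPhase, mul_assoc,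
          densityMode_mul_conj]
        push_cast; ring

/-- **The marked density mode of a translation-invariant weight:**
`Σ_σ n_x(σ) b(σ) ρ_k(σ) = φ_k(x) · (Σ_σ b(σ)|ρ_k(σ)|²)/L²`. [folklore] -/
theorem sum_particleAt_mul_densityMode (b : TensorIndex (TorusSite 2 L) 2 → ℝ)
    (hb : ∀ v σ, b (shiftConfig L v σ) = b σ) (x k : TorusSite 2 L) :
    ∑ σ, (if σ x = 0 then (b σ : ℂ) else 0) * (∑ s, if σ s = 0 then torusPhase L k s else 0)
      = torusPhase L k x *
        ((∑ σ, b σ * ‖(∑ s, if σ s = 0 then torusPhase L k s else 0)‖ ^ 2 : ℝ) : ℂ) / (L : ℂ) ^ 2 := by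
  have hL : ((L : ℂ) ^ 2) ≠ 0 := pow_ne_zero _ (Nat.cast_ne_zero.2 (NeZero.ne L))
  -- `L² F(0) = Σ_x conj φ_k(x) F(x) = Σ_σ b |ρ_k|²`
  have key : ((L : ℂ) ^ 2) *
      (∑ σ, (if σ 0 = 0 then (b σ : ℂ) else 0) * (∑ s, if σ s = 0 then torusPhase L k s else 0))
      = ((∑ σ, b σ * ‖(∑ s, if σ s = 0 then torusPhase L k s else 0)‖ ^ 2 : ℝ) : ℂ) := by
    rw [← sum_conj_phase_mul_particleAt b k]
    have h1 : ∀ y : TorusSite 2 L, conj (torusPhase L k y) *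
        (∑ σ, (if σ y = 0 then (b σ : ℂ) else 0) * (∑ s, if σ s = 0 then torusPhase L k s else 0))
        = ∑ σ, (if σ 0 = 0 then (b σ : ℂ) else 0) * (∑ s, if σ s = 0 then torusPhase L k s else 0) := by
      intro y
      rw [sum_particleAt_mul_densityMode_eq_phase b hb y k, ← mul_assoc, conj_torusPhase_mul, one_mul]
    rw [Finset.sum_congr rfl fun y _ => h1 y, Finset.sum_const, Finset.card_univ, nsmul_eq_mul]
    congr 1
    rw [Fintype.card_fun, ZMod.card, Fintype.card_fin]; push_cast; ring
  rw [sum_particleAt_mul_densityMode_eq_phase b hb x k, eq_div_iff hL, ← key]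
  ring

/-- **The unmarked density mode:** `Σ_σ a(σ)² ρ_k(σ) = (Σ_s ρ_s φ_k(s))`, hence `= [k = 0] · L² ρ` for
an amplitude of uniform site density `ρ`. [folklore] -/
theorem sum_sq_mul_densityMode (a : TensorIndex (TorusSite 2 L) 2 → ℝ) (ρ : ℝ)
    (hdens : ∀ s, siteDensity a s = ρ) (k : TorusSite 2 L) :
    ∑ σ, (a σ ^ 2 : ℂ) * (∑ s, if σ s = 0 then torusPhase L k s else 0)
      = if k = 0 then ((L : ℂ) ^ 2) * (ρ : ℂ) else 0 := by
  have h1 : ∑ σ, (a σ ^ 2 : ℂ) * (∑ s, if σ s = 0 then torusPhase L k s else 0)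
      = ∑ s, ((siteDensity a s : ℝ) : ℂ) * torusPhase L k s := by
    simp_rw [Finset.mul_sum]
    rw [Finset.sum_comm]
    refine Finset.sum_congr rfl fun s _ => ?_
    unfold siteDensity
    push_cast
    rw [Finset.sum_mul]
    refine Finset.sum_congr rfl fun σ _ => ?_
    split_ifs <;> simp
  rw [h1]
  simp_rw [hdens, ← Finset.mul_sum, sum_torusPhase]
  split_ifs <;> ring

/-! ## The transforms of the two insertion laws -/

/-- **Transform of the hole law:** for a translation-invariant amplitude with uniform density `ρ > 0`,
`Σ_τ ν_x(τ) ρ_k(τ) = φ_k(x) · ((Σ_σ a²|ρ_k|²)/(L² ρ) − 1)`. [folklore] -/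
theorem sum_holeLaw_mul_densityMode (a : TensorIndex (TorusSite 2 L) 2 → ℝ) (ρ : ℝ)
    (hb : ∀ v σ, a (shiftConfig L v σ) = a σ) (hdens : ∀ s, siteDensity a s = ρ) (hρ : 0 < ρ)
    (x k : TorusSite 2 L) :
    ∑ τ, (holeLaw a x τ : ℂ) * (∑ s, if τ s = 0 then torusPhase L k s else 0)
      = torusPhase L k x *
        (((∑ σ, a σ ^ 2 * ‖(∑ s, if σ s = 0 then torusPhase L k s else 0)‖ ^ 2 : ℝ) : ℂ)
          / ((L : ℂ) ^ 2 * (ρ : ℂ)) - 1) := by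
  have hρ' : (ρ : ℂ) ≠ 0 := by exact_mod_cast hρ.ne'
  have hL : ((L : ℂ) ^ 2) ≠ 0 := pow_ne_zero _ (Nat.cast_ne_zero.2 (NeZero.ne L))
  -- write the summand as `[τ x = 1] G(update τ x 0)`
  have hG : ∀ τ : TensorIndex (TorusSite 2 L) 2,
      (holeLaw a x τ : ℂ) * (∑ s, if τ s = 0 then torusPhase L k s else 0)
        = if τ x = 1 then
            ((a (Function.update τ x 0) ^ 2 : ℂ) / (ρ : ℂ))
              * ((∑ s, if (Function.update τ x 0) s = 0 then torusPhase L k s else 0) - torusPhase L k x)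
          else 0 := by
    intro τ
    unfold holeLaw
    rw [hdens x]
    split_ifs with h
    · rw [densityMode_update_zero τ x h k]; push_cast; ring
    · push_cast; ring
  simp_rw [hG]
  rw [sum_ite_update_eq (fun σ => ((a σ ^ 2 : ℂ) / (ρ : ℂ))
    * ((∑ s, if σ s = 0 then torusPhase L k s else 0) - torusPhase L k x)) x]
  -- split into the marked mode and the density
  have hsplit : ∑ σ : TensorIndex (TorusSite 2 L) 2, (if σ x = 0 then ((a σ ^ 2 : ℂ) / (ρ : ℂ))
      * ((∑ s, if σ s = 0 then torusPhase L k s else 0) - torusPhase L k x) else 0)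
      = (∑ σ, (if σ x = 0 then ((a σ ^ 2 : ℝ) : ℂ) else 0) * (∑ s, if σ s = 0 then torusPhase L k s else 0))
          / (ρ : ℂ)
        - torusPhase L k x * ((siteDensity a x : ℝ) : ℂ) / (ρ : ℂ) := by
    unfold siteDensity
    push_cast
    rw [Finset.sum_div, Finset.mul_sum, Finset.sum_div, ← Finset.sum_sub_distrib]
    refine Finset.sum_congr rfl fun σ _ => ?_
    split_ifs <;> push_cast <;> ring
  rw [hsplit, sum_particleAt_mul_densityMode (fun σ => a σ ^ 2) (fun v σ => by rw [hb]) x k, hdens x]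
  field_simp

/-- **Transform of the vacancy-conditioned law:** for a translation-invariant amplitude with uniform
density `ρ < 1`, `Σ_τ π̃_x(τ) ρ_k(τ) = ([k = 0] L² ρ − φ_k(x) (Σ_σ a²|ρ_k|²)/L²)/(1 − ρ)`. [folklore] -/
theorem sum_vacantLaw_mul_densityMode (a : TensorIndex (TorusSite 2 L) 2 → ℝ) (ρ : ℝ)
    (hb : ∀ v σ, a (shiftConfig L v σ) = a σ) (hdens : ∀ s, siteDensity a s = ρ) (hρ : ρ < 1)
    (x k : TorusSite 2 L) :
    ∑ τ, (vacantLaw a x τ : ℂ) * (∑ s, if τ s = 0 then torusPhase L k s else 0)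
      = ((if k = 0 then ((L : ℂ) ^ 2) * (ρ : ℂ) else 0)
          - torusPhase L k x *
            ((∑ σ, a σ ^ 2 * ‖(∑ s, if σ s = 0 then torusPhase L k s else 0)‖ ^ 2 : ℝ) : ℂ)
              / (L : ℂ) ^ 2) / (1 - (ρ : ℂ)) := by
  have hρ' : (1 - (ρ : ℂ)) ≠ 0 := by
    have : (1 - ρ : ℝ) ≠ 0 := ne_of_gt (sub_pos.mpr hρ)
    exact_mod_cast this
  have hG : ∀ τ : TensorIndex (TorusSite 2 L) 2,
      (vacantLaw a x τ : ℂ) * (∑ s, if τ s = 0 then torusPhase L k s else 0)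
        = ((a τ ^ 2 : ℂ) * (∑ s, if τ s = 0 then torusPhase L k s else 0)
            - (if τ x = 0 then ((a τ ^ 2 : ℝ) : ℂ) else 0)
                * (∑ s, if τ s = 0 then torusPhase L k s else 0)) / (1 - (ρ : ℂ)) := by
    intro τ
    unfold vacantLaw
    rw [hdens x]
    rcases Fin.exists_fin_two.mp ⟨τ x, rfl⟩ with h | h
    · simp [h]
    · rw [if_pos h, if_neg (by rw [h]; decide)]
      push_cast; ring
  simp_rw [hG]
  rw [← Finset.sum_div, Finset.sum_sub_distrib, sum_sq_mul_densityMode a ρ hdens k,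
    sum_particleAt_mul_densityMode (fun σ => a σ ^ 2) (fun v σ => by rw [hb]) x k]

/-! ## The insertion response in Fourier space -/

/-- `δρ̂_x(k) = Σ_τ (ν_x − π̃_x)(τ) ρ_k(τ)`. [folklore] -/
theorem kernelFT_insertionResponse_eq (aM aN : TensorIndex (TorusSite 2 L) 2 → ℝ) (x k : TorusSite 2 L) :
    kernelFT L (insertionResponse aM aN x) k
      = ∑ τ, (holeLaw aN x τ : ℂ) * (∑ s, if τ s = 0 then torusPhase L k s else 0)
        - ∑ τ, (vacantLaw aM x τ : ℂ) * (∑ s, if τ s = 0 then torusPhase L k s else 0) := by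
  unfold kernelFT insertionResponse
  rw [sum_torusPhase_mul_sum_occ, ← Finset.sum_sub_distrib]
  refine Finset.sum_congr rfl fun τ _ => ?_
  push_cast; ring

/-- **THE STRUCTURE-FACTOR IDENTITY (`k ≠ 0`).**  For translation-invariant amplitudes `aN` (uniform
density `ρ_N > 0`, `P_N = L² ρ_N` particles) and `aM` (uniform density `ρ_M < 1`, `P_M = L² ρ_M > 0`
particles), `δρ̂_x(k) = φ_k(x) · [S_N(k) − 1 + ρ_M S_M(k)/(1 − ρ_M)]` (memo ROTOR-THEORY-7 §91). [folklore] -/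
theorem kernelFT_insertionResponse (aM aN : TensorIndex (TorusSite 2 L) 2 → ℝ) (ρN ρM PN PM : ℝ)
    (hbN : ∀ v σ, aN (shiftConfig L v σ) = aN σ) (hbM : ∀ v σ, aM (shiftConfig L v σ) = aM σ)
    (hdN : ∀ s, siteDensity aN s = ρN) (hdM : ∀ s, siteDensity aM s = ρM)
    (hρN : 0 < ρN) (hρM : ρM < 1) (hPN : PN = (L : ℝ) ^ 2 * ρN) (hPM : PM = (L : ℝ) ^ 2 * ρM)
    (hPM0 : 0 < PM) (x k : TorusSite 2 L) (hk : k ≠ 0) :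
    kernelFT L (insertionResponse aM aN x) k
      = torusPhase L k x *
        ((structureFactor L aN PN k - 1 + ρM * structureFactor L aM PM k / (1 - ρM) : ℝ) : ℂ) := by
  have hL : (0 : ℝ) < (L : ℝ) ^ 2 := by
    have : (0 : ℝ) < (L : ℝ) := by exact_mod_cast Nat.pos_of_ne_zero (NeZero.ne L)
    positivity
  have hPN0 : PN ≠ 0 := by rw [hPN]; positivity
  have hSN := structureFactor_mul aN hPN0 k
  have hSM := structureFactor_mul aM hPM0.ne' k
  rw [kernelFT_insertionResponse_eq, sum_holeLaw_mul_densityMode aN ρN hbN hdN hρN x k,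
    sum_vacantLaw_mul_densityMode aM ρM hbM hdM hρM x k, if_neg hk, ← hSN, ← hSM]
  have hρN' : (ρN : ℂ) ≠ 0 := by exact_mod_cast hρN.ne'
  have hρM' : (1 - (ρM : ℂ)) ≠ 0 := by
    have : (1 - ρM : ℝ) ≠ 0 := ne_of_gt (sub_pos.mpr hρM)
    exact_mod_cast this
  have hLc : ((L : ℂ) ^ 2) ≠ 0 := pow_ne_zero _ (Nat.cast_ne_zero.2 (NeZero.ne L))
  have hLc' : (L : ℂ) ≠ 0 := Nat.cast_ne_zero.2 (NeZero.ne L)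
  rw [hPN, hPM]
  push_cast
  field_simp
  ring

/-- On the support of a sector amplitude the density mode at `k = 0` is the particle number `P`. [folklore] -/
theorem sq_mul_norm_densityMode_zero (Δ M : ℝ) (a : TensorIndex (TorusSite 2 L) 2 → ℝ)
    (ha : IsPerronSectorGroundAmplitude L Δ M a) (σ : TensorIndex (TorusSite 2 L) 2) :
    a σ ^ 2 * ‖(∑ s, if σ s = 0 then torusPhase L 0 s else 0)‖ ^ 2
      = a σ ^ 2 * ((L : ℝ) ^ 2 / 2 + M) ^ 2 := by
  by_cases h0 : a σ = 0
  · rw [h0]; ring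
  · rw [densityMode_zero, Complex.norm_natCast]
    have hc := card_filter_eq_zero_of_mem_sector ha.sector (σ := σ) (by exact_mod_cast h0)
    have hcard : (Fintype.card (TorusSite 2 L) : ℝ) = (L : ℝ) ^ 2 := by
      rw [Fintype.card_fun, ZMod.card, Fintype.card_fin]; push_cast; ring
    rw [hcard] at hc
    rw [hc]

/-- `S_a(0) = P` for a Perron sector amplitude with `P = L²/2 + M` particles. [folklore] -/
theorem structureFactor_zero (Δ M : ℝ) (a : TensorIndex (TorusSite 2 L) 2 → ℝ)
    (ha : IsPerronSectorGroundAmplitude L Δ M a) :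
    structureFactor L a ((L : ℝ) ^ 2 / 2 + M) 0 = (L : ℝ) ^ 2 / 2 + M := by
  unfold structureFactor
  simp_rw [sq_mul_norm_densityMode_zero Δ M a ha]
  rw [← Finset.sum_mul, ha.unit, one_mul]
  by_cases hP : ((L : ℝ) ^ 2 / 2 + M) = 0
  · rw [hP]; simp
  · rw [sq, mul_div_assoc, div_self hP, mul_one]

/-- **THE IDENTITY AT `k = 0`: `δρ̂_x(0) = 0`** — both insertion laws carry exactly `P_N − 1` particles
(Perron amplitudes of the sectors `M` and `M − 1`, densities in `(0,1)`). [folklore] -/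
theorem kernelFT_insertionResponse_zero (Δ M : ℝ) (aM aN : TensorIndex (TorusSite 2 L) 2 → ℝ)
    (haN : IsPerronSectorGroundAmplitude L Δ M aN) (haM : IsPerronSectorGroundAmplitude L Δ (M - 1) aM)
    (hρN : 0 < 1 / 2 + M / (L : ℝ) ^ 2) (hρM : 1 / 2 + (M - 1) / (L : ℝ) ^ 2 < 1)
    (hPM0 : 0 < (L : ℝ) ^ 2 / 2 + (M - 1)) (x : TorusSite 2 L) :
    kernelFT L (insertionResponse aM aN x) 0 = 0 := by
  have hL : (0 : ℝ) < (L : ℝ) ^ 2 := by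
    have : (0 : ℝ) < (L : ℝ) := by exact_mod_cast Nat.pos_of_ne_zero (NeZero.ne L)
    positivity
  have hbN : ∀ v σ, aN (shiftConfig L v σ) = aN σ := perronAmplitude_shiftConfig Δ M aN haN
  have hbM : ∀ v σ, aM (shiftConfig L v σ) = aM σ := perronAmplitude_shiftConfig Δ (M - 1) aM haM
  have hdN : ∀ s, siteDensity aN s = 1 / 2 + M / (L : ℝ) ^ 2 :=
    fun s => siteDensity_eq_of_isPerron L Δ M aN haN s
  have hdM : ∀ s, siteDensity aM s = 1 / 2 + (M - 1) / (L : ℝ) ^ 2 :=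
    fun s => siteDensity_eq_of_isPerron L Δ (M - 1) aM haM s
  have hPN0 : ((L : ℝ) ^ 2 / 2 + M) ≠ 0 := by
    have hL' : (L : ℝ) ≠ 0 := by exact_mod_cast (NeZero.ne L)
    have : (L : ℝ) ^ 2 / 2 + M = (L : ℝ) ^ 2 * (1 / 2 + M / (L : ℝ) ^ 2) := by field_simp
    rw [this]; positivity
  have hSN := structureFactor_mul aN hPN0 0
  have hSM := structureFactor_mul aM hPM0.ne' 0
  rw [structureFactor_zero Δ M aN haN] at hSN
  rw [structureFactor_zero Δ (M - 1) aM haM] at hSM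
  rw [kernelFT_insertionResponse_eq, sum_holeLaw_mul_densityMode aN _ hbN hdN hρN x 0,
    sum_vacantLaw_mul_densityMode aM _ hbM hdM hρM x 0, if_pos rfl, ← hSN, ← hSM, torusPhase_zero_left]
  -- the real identity `P_N²/(L² ρ_N) − 1 − (L² ρ_M − P_M²/L²)/(1 − ρ_M) = P_N − 1 − P_M = 0`
  have hL' : (L : ℝ) ≠ 0 := by exact_mod_cast (NeZero.ne L)
  have hB : (1 - (1 / 2 + (M - 1) / (L : ℝ) ^ 2)) ≠ 0 := ne_of_gt (sub_pos.mpr hρM)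
  have e1 : (L : ℝ) ^ 2 * (1 / 2 + M / (L : ℝ) ^ 2) = (L : ℝ) ^ 2 / 2 + M := by
    field_simp
  have e2 : ((L : ℝ) ^ 2 / 2 + (M - 1)) * ((L : ℝ) ^ 2 / 2 + (M - 1)) / (L : ℝ) ^ 2
      = ((L : ℝ) ^ 2 / 2 + (M - 1)) * (1 / 2 + (M - 1) / (L : ℝ) ^ 2) := by
    field_simp
  have e3 : (L : ℝ) ^ 2 * (1 / 2 + (M - 1) / (L : ℝ) ^ 2) = (L : ℝ) ^ 2 / 2 + (M - 1) := by
    field_simp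
  have e4 : ((L : ℝ) ^ 2 / 2 + (M - 1)) - ((L : ℝ) ^ 2 / 2 + (M - 1)) * (1 / 2 + (M - 1) / (L : ℝ) ^ 2)
      = ((L : ℝ) ^ 2 / 2 + (M - 1)) * (1 - (1 / 2 + (M - 1) / (L : ℝ) ^ 2)) := by ring
  have key : ((L : ℝ) ^ 2 / 2 + M) * ((L : ℝ) ^ 2 / 2 + M) / ((L : ℝ) ^ 2 * (1 / 2 + M / (L : ℝ) ^ 2)) - 1
      - ((L : ℝ) ^ 2 * (1 / 2 + (M - 1) / (L : ℝ) ^ 2)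
          - ((L : ℝ) ^ 2 / 2 + (M - 1)) * ((L : ℝ) ^ 2 / 2 + (M - 1)) / (L : ℝ) ^ 2)
          / (1 - (1 / 2 + (M - 1) / (L : ℝ) ^ 2)) = 0 := by
    rw [e1, e2, e3, e4, mul_div_assoc, div_self hPN0, mul_one, mul_div_assoc, div_self hB, mul_one]
    ring
  have key' := congrArg (fun r : ℝ => (r : ℂ)) key
  push_cast at key' ⊢
  linear_combination key'

/-- **THE BOUND: `|δρ̂_x(k)| ≤ S_N(k) + 1 + ρ_M S_M(k)/(1 − ρ_M)`** (`k ≠ 0`, hypotheses of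
`kernelFT_insertionResponse`). [folklore] -/
theorem norm_kernelFT_insertionResponse_le (aM aN : TensorIndex (TorusSite 2 L) 2 → ℝ) (ρN ρM PN PM : ℝ)
    (hbN : ∀ v σ, aN (shiftConfig L v σ) = aN σ) (hbM : ∀ v σ, aM (shiftConfig L v σ) = aM σ)
    (hdN : ∀ s, siteDensity aN s = ρN) (hdM : ∀ s, siteDensity aM s = ρM)
    (hρN : 0 < ρN) (hρM0 : 0 ≤ ρM) (hρM : ρM < 1) (hPN : PN = (L : ℝ) ^ 2 * ρN)
    (hPM : PM = (L : ℝ) ^ 2 * ρM) (hPM0 : 0 < PM) (x k : TorusSite 2 L) (hk : k ≠ 0) :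
    ‖kernelFT L (insertionResponse aM aN x) k‖
      ≤ structureFactor L aN PN k + 1 + ρM * structureFactor L aM PM k / (1 - ρM) := by
  rw [kernelFT_insertionResponse aM aN ρN ρM PN PM hbN hbM hdN hdM hρN hρM hPN hPM hPM0 x k hk, norm_mul,
    norm_torusPhase, one_mul, Complex.norm_real, Real.norm_eq_abs]
  have hL : (0 : ℝ) < (L : ℝ) ^ 2 := by
    have : (0 : ℝ) < (L : ℝ) := by exact_mod_cast Nat.pos_of_ne_zero (NeZero.ne L)
    positivity
  have hSN : 0 ≤ structureFactor L aN PN k := structureFactor_nonneg aN (by rw [hPN]; positivity) k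
  have hSM : 0 ≤ structureFactor L aM PM k := structureFactor_nonneg aM hPM0.le k
  have h3 : 0 ≤ ρM * structureFactor L aM PM k / (1 - ρM) :=
    div_nonneg (mul_nonneg hρM0 hSM) (sub_pos.mpr hρM).le
  rw [abs_le]
  constructor <;> linarith

end Summit.HubbardSuperconductivity.HubbardSuperconductivity.Theorems.AnisotropyChord.InsertionEntropy
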